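import Summits.ABC.StewartYu.ArchG3Sizes
import Summits.ABC.StewartYu.ArchG3Values
import Summits.ABC.StewartYu.ArchG3Supply
import HarnessLib

/-!
# Cell abc-stewartyu, rung A1.L (crux r2 `ArchCoreRat`), parcel WP-L.A P-A4: the JETS OF THE EXTRAPOLATED FUNCTION AT AN OLD NODE, assembled —
# from the Δ-invariant at the node to `‖f_{a,μ}^{(σ)}(x)‖ ≤ σ!·ε_J` (the input of the Taylor-normalised Hermite step)

`Summits/ABC/StewartYu/ArchG3NodeJets.lean` — composition layer over `ArchG3Sizes` (growth / comparison / envelope / normalised jets),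
`ArchG3Values` (Δ-weighted coefficients `pvΔ`, change of basis) and `ArchG3Supply` (Fel'dman `Y₀`-weights `scaledFeldR`); cell `abc-stewartyu`,
seat p5-g7; rulings R26(a)/(e) (HOME/STATUS 2026-08-27T15:06Z/15:10Z).  Theorems only; no named fact, no parameters.

For the archimedean frame's extrapolated function `f_{a,μ} = archF R v B (pvΔ pv c e μ) (a, 0)` with `R i = Δ(·; ℓ₀ i, H) ∘ 2^{e'}·`
(print's `f` of (4.17) for the multi-index `(a; μ)`), at an integer node `x` where the level invariant holds in Δ-form
(`archφ R v B (pvΔ pv c e μ′) (a′, 0) x = 0` for `a′ + |μ′| < T`):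

* `archF_pvΔ_envelope` — the value envelope `‖archF (pvΔ μ) τ′ x‖ ≤ ε·∏Γ^{τ′.2}` for `|μ| + |τ′| < T`, with
  `ε = #B·P_Δ·W·e^{Lmax|x|}·(2V₀|Λ/b_{j₀}||x|)` (`P_Δ ≥ |pvΔ μ i|`, `W` = the uniform Fel'dman bound of `ArchSupply` up to Hasse order `T`);
* **`norm_iteratedDeriv_archF_pvΔ_le`** — for `a + σ + |μ| < T` and any `C ≥ 1`:
  `‖f_{a,μ}^{(σ)}(x)‖ ≤ σ! · ε · 2^{a+σ} · C^σ · exp((Σₖ AₖΓₖ)/C)` — print's Lemma 4.3 (4.19) in the frame's currencies: per derivative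
  `log 2 + log C`, the logarithms' size only through `Σ AₖΓₖ / C` (choose `C ≈ eB`), no `Γ^{M̂}`, no `log T`.

WHAT THIS IS NOT: no Hermite / Cauchy step, no Liouville conclusion (lp-1's `ArchLvInv.kstep`); no parameters; no crux moves.

References: Yu. V. Nesterenko, LNM 1819 (2003), §4.2 Lemma 4.3, (4.19)–(4.23).
-/

noncomputable section

open Finset Polynomial
open Literature.NumberTheory.Transcendental
open Literature.NumberTheory.Transcendental.CW77.Setup (Tau tauNorm)
open Summit.ABC.StewartYu.ArchJets (jetMaj env jetMaj_le_scaled)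
open Summit.ABC.StewartYu.ArchSupply (scaledFeldR abs_hasse_scaledFeldR_eval_le_of_le)
open scoped Nat

namespace Summit.ABC.StewartYu

namespace ArchG3Setup

variable (S : ArchG3Setup) {ι : Type*} (ℓ₀ : ι → ℕ) (H e : ℕ) (v : ι → Fin S.n → ℤ)

/-- **The value envelope of the Δ-family at an old node.**  With `R i = Δ(·; ℓ₀ i, H) ∘ 2^e·` (`H ≥ 1`, `ℓ₀ i ≤ L₀` on `B`), the
Δ-invariant at the integer node `x` up to order `T` (`c ≠ 0`), `|pvΔ μ i| ≤ P_Δ`, `|zγ(vᵢ)ₖ| ≤ Γₖ`, `|Lsum vᵢ| ≤ Lmax`, `|vᵢ,j₀| ≤ V₀`,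
`|x| ≤ Xb` and `V₀|Λ/b_{j₀}||x| ≤ 1`: for every `τ′` with `|μ| + |τ′| < T`,
`‖archF R v B (pvΔ μ) τ′ x‖ ≤ (#B·P_Δ·W·e^{Lmax|x|}·2V₀|Λ/b_{j₀}||x|)·∏ₖΓₖ^{τ′ₖ}`, `W = 2^{eT} e^{H/e} (e(1+2^eXb/H))^{L₀}`.
[cite: Nesterenko2003, §4.2 (4.21)–(4.22)] -/
theorem archF_pvΔ_envelope (hH : 1 ≤ H) (B : Finset ι) (pv : ι → ℤ) {c : ℤ} (hc : c ≠ 0) (eΔ : Fin S.n → ℤ)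
    (μ : Fin S.n → ℕ) (x : ℤ) (T : ℕ) {L₀ : ℕ} (hL₀ : ∀ i ∈ B, ℓ₀ i ≤ L₀)
    (hinv : ∀ (a' : ℕ) (μ' : Fin S.n → ℕ), a' + ∑ k, μ' k < T →
      S.archφ (fun i => scaledFeldR (ℓ₀ i) H e) v B (S.pvΔ v pv c eΔ μ') (a', 0) x = 0)
    {PΔ Lmax V₀ Xb : ℝ} {Γ : Fin S.n → ℝ} (hP : ∀ i ∈ B, |(S.pvΔ v pv c eΔ μ i : ℝ)| ≤ PΔ)
    (hΓ : ∀ i ∈ B, ∀ k, |(S.zγ (v i) k : ℝ)| ≤ Γ k) (hL : ∀ i ∈ B, |S.Lsum (v i)| ≤ Lmax)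
    (hV₀ : ∀ i ∈ B, |(v i S.j₀ : ℝ)| ≤ V₀) (hx : |(x : ℝ)| ≤ Xb) (hsmall : V₀ * |S.Λ / (S.b S.j₀ : ℝ)| * |(x : ℝ)| ≤ 1) :
    ∀ τ' : Tau S.n, (∑ k, μ k) + tauNorm τ' < T →
      ‖S.archF (fun i => scaledFeldR (ℓ₀ i) H e) v B (S.pvΔ v pv c eΔ μ) τ' (x : ℂ)‖ ≤
        (B.card * PΔ * ((2 : ℝ) ^ (e * T) * (Real.exp (H / Real.exp 1) * (Real.exp 1 * (1 + (2 : ℝ) ^ e * Xb / H)) ^ L₀)) *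
          Real.exp (Lmax * |(x : ℝ)|) * (2 * (V₀ * |S.Λ / (S.b S.j₀ : ℝ)| * |(x : ℝ)|))) * env 1 Γ τ' := by
  intro τ' hτ'
  -- the mixed values vanish up to order `N := T − 1 − |μ|` by the change of basis
  have hN : ∀ τ : Tau S.n, tauNorm τ ≤ T - 1 - ∑ k, μ k →
      S.archφ (fun i => scaledFeldR (ℓ₀ i) H e) v B (S.pvΔ v pv c eΔ μ) τ x = 0 :=
    fun τ hτ => S.archφ_pvΔ_eq_zero_of_invariant _ v B pv hc eΔ x T hinv μ τ (by omega)
  -- the Fel'dman weights are uniformly bounded up to Hasse order `T − 1 − |μ| ≤ T`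
  have hW : ∀ i ∈ B, ∀ t₀ ≤ T - 1 - ∑ k, μ k,
      |(((hasseDeriv t₀ (scaledFeldR (ℓ₀ i) H e)).eval (x : ℚ) : ℚ) : ℝ)| ≤
        (2 : ℝ) ^ (e * T) * (Real.exp (H / Real.exp 1) * (Real.exp 1 * (1 + (2 : ℝ) ^ e * Xb / H)) ^ L₀) :=
    fun i hi t₀ ht₀ => abs_hasse_scaledFeldR_eval_le_of_le ℓ₀ hH e i (hL₀ i hi) (by omega) hx
  exact S.archF_envelope_of_vanishing (fun i => scaledFeldR (ℓ₀ i) H e) v B (S.pvΔ v pv c eΔ μ) x (T - 1 - ∑ k, μ k) hN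
    hP hW hΓ hL hV₀ hsmall τ' (by omega)

/-- **The jets of the extrapolated function at an old node (print's Lemma 4.3).**  Under the data of `archF_pvΔ_envelope` with
`Γₖ ≥ 0`, `|log αₖ| ≤ Aₖ`, and any `C ≥ 1`: for `a + σ + |μ| < T`,
`‖(archF R v B (pvΔ μ) (a, 0))^{(σ)}(x)‖ ≤ σ! · ε · (2^{a+σ} · C^σ · exp((Σₖ AₖΓₖ)/C))`,
`ε = #B·P_Δ·W·e^{Lmax|x|}·2V₀|Λ/b_{j₀}||x|` — the `σ!·ε_J` input of the Taylor-normalised Hermite step (R26(a)).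
[cite: Nesterenko2003, §4.2 Lemma 4.3 (4.19)–(4.23)] -/
theorem norm_iteratedDeriv_archF_pvΔ_le (hH : 1 ≤ H) (B : Finset ι) (pv : ι → ℤ) {c : ℤ} (hc : c ≠ 0)
    (eΔ : Fin S.n → ℤ) (μ : Fin S.n → ℕ) (x : ℤ) (T : ℕ) {L₀ : ℕ} (hL₀ : ∀ i ∈ B, ℓ₀ i ≤ L₀)
    (hinv : ∀ (a' : ℕ) (μ' : Fin S.n → ℕ), a' + ∑ k, μ' k < T →
      S.archφ (fun i => scaledFeldR (ℓ₀ i) H e) v B (S.pvΔ v pv c eΔ μ') (a', 0) x = 0)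
    {PΔ Lmax V₀ Xb : ℝ} {Γ A : Fin S.n → ℝ} (hP : ∀ i ∈ B, |(S.pvΔ v pv c eΔ μ i : ℝ)| ≤ PΔ)
    (hΓ0 : ∀ k, 0 ≤ Γ k) (hΓ : ∀ i ∈ B, ∀ k, |(S.zγ (v i) k : ℝ)| ≤ Γ k) (hA : ∀ k, |S.lg k| ≤ A k)
    (hL : ∀ i ∈ B, |S.Lsum (v i)| ≤ Lmax) (hV₀ : ∀ i ∈ B, |(v i S.j₀ : ℝ)| ≤ V₀) (hx : |(x : ℝ)| ≤ Xb)
    (hsmall : V₀ * |S.Λ / (S.b S.j₀ : ℝ)| * |(x : ℝ)| ≤ 1) {C : ℝ} (hC : 1 ≤ C)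
    {a σ : ℕ} (haσ : a + σ + ∑ k, μ k < T) :
    ‖iteratedDeriv σ (S.archF (fun i => scaledFeldR (ℓ₀ i) H e) v B (S.pvΔ v pv c eΔ μ) ((a, 0) : Tau S.n)) (x : ℂ)‖ ≤
      (σ ! : ℝ) * (B.card * PΔ * ((2 : ℝ) ^ (e * T) * (Real.exp (H / Real.exp 1) * (Real.exp 1 * (1 + (2 : ℝ) ^ e * Xb / H)) ^ L₀)) *
          Real.exp (Lmax * |(x : ℝ)|) * (2 * (V₀ * |S.Λ / (S.b S.j₀ : ℝ)| * |(x : ℝ)|))) *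
        ((2 : ℝ) ^ (a + σ) * C ^ σ * Real.exp ((∑ k, A k * Γ k) / C)) := by
  set R : ι → ℚ[X] := fun i => scaledFeldR (ℓ₀ i) H e with hR
  set ε : ℝ := B.card * PΔ * ((2 : ℝ) ^ (e * T) * (Real.exp (H / Real.exp 1) * (Real.exp 1 * (1 + (2 : ℝ) ^ e * Xb / H)) ^ L₀)) *
      Real.exp (Lmax * |(x : ℝ)|) * (2 * (V₀ * |S.Λ / (S.b S.j₀ : ℝ)| * |(x : ℝ)|)) with hε
  -- the envelope up to `N := T − 1 − |μ|`
  have henv : ∀ τ' : Tau S.n, tauNorm τ' ≤ T - 1 - ∑ k, μ k → ‖S.archF R v B (S.pvΔ v pv c eΔ μ) τ' (x : ℂ)‖ ≤ ε * env 1 Γ τ' :=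
    fun τ' hτ' => S.archF_pvΔ_envelope ℓ₀ H e v hH B pv hc eΔ μ x T hL₀ hinv hP hΓ hL hV₀ hx hsmall τ' (by omega)
  -- the normalised jets
  have hjet := S.norm_iteratedDeriv_archF_le_jetMaj R v B (S.pvΔ v pv c eΔ μ) hA zero_le_one hΓ0 (x : ℂ) (T - 1 - ∑ k, μ k) henv
    σ (a, 0) (by unfold tauNorm; simp; omega)
  have henv1 : env 1 Γ ((a, 0) : Tau S.n) = 1 := by simp [env]
  rw [henv1, mul_one] at hjet
  refine hjet.trans ?_
  -- bound the majorant
  have hy0 : 0 ≤ ∑ k, A k * Γ k := sum_nonneg fun k _ => mul_nonneg ((abs_nonneg _).trans (hA k)) (hΓ0 k)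
  have hJ := jetMaj_le_scaled zero_le_one hy0 hC a σ
  rw [max_self, one_pow, mul_one] at hJ
  have hε0 : 0 ≤ ε := by
    have hB : B = ∅ ∨ B.Nonempty := B.eq_empty_or_nonempty
    rcases hB with hB | ⟨i, hi⟩
    · simp [hε, hB]
    · have hP0 : 0 ≤ PΔ := (abs_nonneg _).trans (hP i hi)
      have hV0 : 0 ≤ V₀ := (abs_nonneg _).trans (hV₀ i hi)
      have hXb : 0 ≤ Xb := (abs_nonneg _).trans hx
      positivity
  exact mul_le_mul_of_nonneg_left hJ (by positivity)

end ArchG3Setup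

end Summit.ABC.StewartYu

end
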